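import Literature.NumberTheory.EllipticCurves.TateModuleInertiaReductionProofs
import HarnessLib

/-!
# `codim (V_ℓ E)^H = 1` from reduction data whose image contains the `ℓ`-power torsion
# (Silverman *ATAEC* IV.10.2(a), multiplicative case — a variant of the shape lemma)

`Proofs` file (theorems only) refining `TateModuleComparisonProofs` /
`TateModuleInertiaReductionProofs` (landed by the tenured seat of bsd.S15,
`Literature.NumberTheory.EllipticCurves.conductorNorm_eq_artinConductorNat`).  The multiplicative
shape lemma of those files (`TateModule.finrank_eq_one_of_reduction`,
`codimFixed_rationalTate_eq_one_of_reduction`: Silverman, *ATAEC*, proof of Thm. IV.10.2(a), PDF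
p. 359, *"`V_ℓ(E(K^nr)) ≃ V_ℓ(E₀(K^nr)) ≃ V_ℓ(Ẽ_ns(k̄)) = V_ℓ(k̄^*) ≅ ℚ_ℓ`"*) asks for a homomorphism
`r : A' → k̄ˣ` which is **surjective** — the surjectivity of reduction `E₀(K^nr) → Ẽ_ns(k̄)`
(Hensel over `K^nr`).  In the tree's rendering inside `K̄_v` (points fixed by the inertia group
rather than points over `K^nr`) surjectivity onto all of `Ẽ_ns(k̄)` from the *inertia-fixed* part
of `E₀(K̄_v)` is not what comes out naturally; what does is that the image contains every
`ℓ`-power torsion element of `k̄ˣ` (torsion points of `E₀(K̄_v)` are automatically fixed by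
inertia).  Since `T_ℓ` only sees the `ℓ`-power torsion
(`TateModule.map_bijective_of_injective_of_forall_mem_range`), this suffices:

* `Literature.NumberTheory.EllipticCurves.TateModule.finrank_eq_one_of_reduction_of_forall_mem_range`
  — as `finrank_eq_one_of_reduction` with `Function.Surjective r` weakened to
  "every `ℓ`-power torsion element of `k̄ˣ` is in the range of `r`" (corestrict `r` to its image
  `B ≤ k̄ˣ`; `T_ℓ B ≅ T_ℓ k̄ˣ`);
* `WeierstrassCurve.codimFixed_rationalTate_eq_one_of_reduction_of_forall_mem_range` (any field,
  any `H ≤ Γ_F`) and `WeierstrassCurve.codimFixed_inertia_rationalTate_eq_one_of_reduction'`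
  (number field, `H = I_𝔓`) — the corresponding variants of the codimension statements.

## References

* J. H. Silverman, *Advanced Topics in the Arithmetic of Elliptic Curves*, GTM 151 (1994), §IV.10,
  proof of Thm. 10.2(a), PDF p. 359. [SilvermanATAEC1994]
* J. H. Silverman, *The Arithmetic of Elliptic Curves*, 2nd ed. (2009), III.§7 (the Tate module).
  [SilvermanAEC2009]

## Design

No definitions; `noncomputable section`; same universes and spellings as
`TateModuleInertiaReductionProofs`.
-/

noncomputable section

open scoped Classical AddSubgroup NumberField
open Field IsDedekindDomain

universe u v

namespace Literature.NumberTheory.EllipticCurves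

namespace TateModule

variable {A : Type u} [AddCommGroup A] {p : ℕ} [Fact p.Prime] {F : Type v} [Field F]

/-- **Multiplicative shape with "image ⊇ `p`-power torsion".**  If `A[p]` is finite, `A' ≤ A` has
finite exponent-index (`c • A ⊆ A'`, `c ≠ 0`), and `r : A' →+ F^×` (additively written, `F`
separably closed with `(p : F) ≠ 0`) has uniquely `p`-divisible kernel and an image containing
every `p`-power torsion element of `F^×`, then `rank_{ℤ_p} T_p A = 1`.  Silverman, *ATAEC*,
proof of Thm. IV.10.2(a), PDF p. 359, with `T_p` of the image `B = r(A')` in place of `T_p(k̄^*)`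
(`T_p B ≅ T_p F^×` because `B ⊇ F^×[p^∞]`, `map_bijective_of_injective_of_forall_mem_range`).
[cite: SilvermanATAEC1994, proof of Thm. IV.10.2(a), PDF p. 359] -/
theorem finrank_eq_one_of_reduction_of_forall_mem_range [IsSepClosed F]
    (hfin : Finite (A[(p : ℕ)])) (A' : AddSubgroup A) {c : ℕ} (hc : c ≠ 0)
    (hA' : ∀ a : A, c • a ∈ A') (hp : (p : F) ≠ 0) (r : A' →+ Additive Fˣ)
    (hr : ∀ b : Additive Fˣ, ∀ n : ℕ, p ^ n • b = 0 → b ∈ r.range)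
    (htf : ∀ a : A', r a = 0 → p • a = 0 → a = 0)
    (hdiv : ∀ a : A', r a = 0 → ∃ b : A', r b = 0 ∧ p • b = a) :
    Module.finrank ℤ_[p] (TateModule A p) = 1 := by
  rw [← finrank_eq_of_nsmul_mem A' hc hA' hfin]
  -- corestriction of `r` to its image `B`
  set B : AddSubgroup (Additive Fˣ) := r.range with hB
  set r' : A' →+ B := r.rangeRestrict with hr'
  have hr'0 : ∀ a : A', r' a = 0 ↔ r a = 0 := fun a ↦ by
    rw [hr', ← Subtype.coe_inj, AddMonoidHom.coe_rangeRestrict, AddSubgroup.coe_zero]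
  have h1 : Module.finrank ℤ_[p] (TateModule A' p) = Module.finrank ℤ_[p] (TateModule B p) := by
    refine finrank_eq_of_surjective_of_ker r' (AddMonoidHom.rangeRestrict_surjective r)
      (fun a ha ↦ htf a ((hr'0 a).mp ha)) (fun a ha ↦ ?_)
    obtain ⟨b, hb, hba⟩ := hdiv a ((hr'0 a).mp ha)
    exact ⟨b, (hr'0 b).mpr hb, hba⟩
  have h2 : Module.finrank ℤ_[p] (TateModule B p) =
      Module.finrank ℤ_[p] (TateModule (Additive Fˣ) p) :=
    (LinearEquiv.ofBijective (map p B.subtype)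
      (map_bijective_of_injective_of_forall_mem_range B.subtype Subtype.val_injective
        (fun b n hb ↦ ⟨⟨b, hr b n hb⟩, rfl⟩))).finrank_eq
  rw [h1, h2, finrank_tateModule_additive_units p hp]

end TateModule

end Literature.NumberTheory.EllipticCurves

namespace WeierstrassCurve

open Literature.NumberTheory.EllipticCurves Literature.NumberTheory.GaloisRepresentations

section AnyField

variable {F : Type u} [Field F] (W : WeierstrassCurve F) (ℓ : ℕ) [Fact ℓ.Prime]
  {k : Type v} [Field k]

/-- **Multiplicative shape, any subgroup, image ⊇ `ℓ`-power torsion.**  For an elliptic curve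
`E/F`, `ℓ ≠ char F`, `H ≤ Γ_F`: if `E(F̄)^H` has a subgroup `A'` with `c • E(F̄)^H ⊆ A'` (`c ≠ 0`)
and a homomorphism `r` to the multiplicative group of a separably closed field of characteristic
`≠ ℓ` with uniquely `ℓ`-divisible kernel whose image contains all `ℓ`-power roots of unity, then
`codim (V_ℓ E)^H = 1`.  Variant of `codimFixed_rationalTate_eq_one_of_reduction`
(`TateModuleInertiaReductionProofs`).  Silverman *ATAEC*, proof of IV.10.2(a), PDF p. 359.
[cite: SilvermanATAEC1994, proof of Thm. IV.10.2(a), PDF p. 359] -/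
theorem codimFixed_rationalTate_eq_one_of_reduction_of_forall_mem_range [W.IsElliptic]
    [IsSepClosed k] (hℓ : (ℓ : F) ≠ 0) (hℓk : (ℓ : k) ≠ 0)
    (h : Continuous fun x : absoluteGaloisGroup F × RationalTateModule (geomPoints W) ℓ ↦
      rationalTateRepresentation (absoluteGaloisGroup F) (geomPoints W) ℓ x.1 x.2)
    (H : Subgroup (absoluteGaloisGroup F))
    (A' : AddSubgroup (FixedPoints.addSubgroup H (geomPoints W))) {c : ℕ} (hc : c ≠ 0)
    (hA' : ∀ P : FixedPoints.addSubgroup H (geomPoints W), c • P ∈ A')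
    (r : A' →+ Additive kˣ)
    (hr : ∀ b : Additive kˣ, ∀ n : ℕ, ℓ ^ n • b = 0 → b ∈ r.range)
    (htf : ∀ P : A', r P = 0 → ℓ • P = 0 → P = 0)
    (hdiv : ∀ P : A', r P = 0 → ∃ Q : A', r Q = 0 ∧ ℓ • Q = P) :
    (rationalTateGaloisRepOf (geomPoints W) ℓ h).codimFixed H = 1 := by
  refine (W.codimFixed_rationalTate_eq_one_iff ℓ hℓ h H).mpr ?_
  have hfin : Finite ((FixedPoints.addSubgroup H (geomPoints W))[(ℓ : ℕ)]) :=
    finite_torsionBy_of_injective (FixedPoints.addSubgroup H (geomPoints W)).subtype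
      (fun _ _ h ↦ Subtype.ext h) _ (W.finite_geomTorsion_prime ℓ)
  exact TateModule.finrank_eq_one_of_reduction_of_forall_mem_range hfin A' hc hA' hℓk r hr htf
    hdiv

end AnyField

section NumberField

variable {K : Type u} [Field K] [NumberField K] (W : WeierstrassCurve K) (ℓ : ℕ) [Fact ℓ.Prime]
  {k : Type v} [Field k]

/-- **Multiplicative case of *ATAEC* IV.10.2(a) from reduction data at `𝔓`, image ⊇ `ℓ`-power
torsion** (variant of `codimFixed_inertia_rationalTate_eq_one_of_reduction` with surjectivity of
`r` weakened): `codim_{ℚ_ℓ} (V_ℓ E)^{I_𝔓} = 1`.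
[cite: SilvermanATAEC1994, proof of Thm. IV.10.2(a), PDF p. 359] -/
theorem codimFixed_inertia_rationalTate_eq_one_of_reduction' [W.IsElliptic] [IsSepClosed k]
    (hℓk : (ℓ : k) ≠ 0)
    (h : Continuous fun x : absoluteGaloisGroup K × RationalTateModule (geomPoints W) ℓ ↦
      rationalTateRepresentation (absoluteGaloisGroup K) (geomPoints W) ℓ x.1 x.2)
    (𝔓 : Ideal (absIntegers (𝓞 K) K))
    (A' : AddSubgroup (FixedPoints.addSubgroup (𝔓.inertia (absoluteGaloisGroup K)) (geomPoints W)))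
    {c : ℕ} (hc : c ≠ 0)
    (hA' : ∀ P : FixedPoints.addSubgroup (𝔓.inertia (absoluteGaloisGroup K)) (geomPoints W),
      c • P ∈ A')
    (r : A' →+ Additive kˣ)
    (hr : ∀ b : Additive kˣ, ∀ n : ℕ, ℓ ^ n • b = 0 → b ∈ r.range)
    (htf : ∀ P : A', r P = 0 → ℓ • P = 0 → P = 0)
    (hdiv : ∀ P : A', r P = 0 → ∃ Q : A', r Q = 0 ∧ ℓ • Q = P) :
    (rationalTateGaloisRepOf (geomPoints W) ℓ h).codimFixed (𝔓.inertia (absoluteGaloisGroup K)) =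
      1 :=
  W.codimFixed_rationalTate_eq_one_of_reduction_of_forall_mem_range ℓ
    (by exact_mod_cast (Fact.out : ℓ.Prime).ne_zero) hℓk h _ A' hc hA' r hr htf hdiv

end NumberField

end WeierstrassCurve

end
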